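import Summits.ValiantsHypothesis.ValiantsHypothesis.Theorems.BorderApolarityFixedWitnessObstructionQPOrderChain
import Summits.ValiantsHypothesis.ValiantsHypothesis.Theorems.BorderApolarityFixedWitnessObstructionQPNecessityWindow

/-!
# Border apolarity, crux `FixedWitnessObstructionQP` — the order chain PER INSTANCE, and its WINDOWED form

Route `ValiantsHypothesis/BorderApolarity`, crux item `stmt-ValiantsHypothesis-5778`, line `toric-face-debordering`,
reshape 5 (lead seat -2).  `…QPOrderChain.lean` states the chain `PotentialGapQP ⟹ OrderBoundQP ⟹ ToricDeborderQP` for the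
GLOBAL stubs (`∃ c₁ ∀ n m`).  Seat c2 (`…QPNecessityWindow.lean`) observed that only the WINDOWED de-bordering stub
(`∃ c₁ ∀ c ∃ n₀ ∀ n ≥ n₀ ∀ m ≤ 2^((log₂ n + c)^c)`) is used and that with it the line is EXACT (≡ crux given `ToricFixedPoints`).
This file therefore lands the chain at the level where the mathematics lives — ONE instance `(n, m)` with explicit size
bounds — and derives the windowed chain from it:

* `determinantalComplexity_perPoly_le_of_orderRep` — `pp_{n,m} = u · [ε^k] det (B₀ + ⋯ + ε^k B_k)` (linear layers) ⟹
  `dc(per_n) ≤ 3((m+1)(k+1))^10` (`stub_deborderOrder` + `hasDetRepr_linSubst` + `stub_unpad`);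
* `exists_orderRep_of_potentialRep` — a toric representation `pp = u · wHC_w^e (g · det_m)` with feasible potentials of gap
  `k = Σp + Σq − e` IS such an order-`k` representation (`stub_deborderFrame`);
* `determinantalComplexity_perPoly_le_of_potentialRep` (registered stub `stub_dcLeOfPotentialRep`) — hence
  `dc(per_n) ≤ 3((m+1)(Σp+Σq−e+1))^10`: **the determinantal complexity of the permanent is polynomial in the size and the
  Murota gap of any toric representation of its padding**;
* `toricDeborderQPWindow_of_potentialGapQPWindow` — the windowed chain (a quasi-polynomial gap inside the window suffices),
  and `fixedWitnessObstructionQP_of_potentialGapQPWindow` — crux 2 from `ToricFixedPoints`, the windowed gap bound and the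
  eventual super-qp growth of `dc(per_n)` (through seat c2's `noExtremalInitialForm_of_toricDeborderQPWindow`).
-/

open scoped BigOperators Matrix Polynomial
open Literature.Computability.AlgebraicComplexity
open Summit.ValiantsHypothesis.ValiantsHypothesis.Theses
open Summit.ValiantsHypothesis.ValiantsHypothesis.Theses.BorderApolarity

namespace Summit.ValiantsHypothesis.ValiantsHypothesis.Theorems.BorderApolarityFixedWitnessObstructionQP

set_option linter.dupNamespace false

/-- **Order representations de-border at polynomial cost in (size × order)**: if the padded permanent is a translate of
the order-`k` coefficient of a holomorphic family of `m × m` matrices of linear forms, then `dc(per_n) ≤ 3((m+1)(k+1))^10`.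
[folklore] -/
theorem determinantalComplexity_perPoly_le_of_orderRep {n m : ℕ} [NeZero m] (hnm : n ≤ m) (k : ℕ)
    (u : Matrix (Fin m × Fin m) (Fin m × Fin m) ℂ) (B : ℕ → Matrix (Fin m) (Fin m) (MvPolynomial (Fin m × Fin m) ℂ))
    (hB : ∀ j a b, (B j a b).IsHomogeneous 1)
    (hpp : paddedPerPoly ℂ n m = linSubst (Fin m × Fin m) ℂ u
      ((Matrix.det (Matrix.of fun a b =>
        ∑ j ∈ Finset.range (k + 1), Polynomial.monomial j (B j a b))).coeff k)) :
    determinantalComplexity (perPoly (Fin n) ℂ) ≤ 3 * ((m + 1) * (k + 1)) ^ 10 := by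
  have hcoef := hasDetRepr_coeff_det_layers m k B hB
  have hpad : HasDetRepr (paddedPerPoly ℂ n m) (3 * ((m + 1) * (k + 1)) ^ 10) := by
    rw [hpp]
    exact hasDetRepr_linSubst _ hcoef
  exact determinantalComplexity_le_of_hasDetRepr (stub_unpad n m hnm _ hpad)

/-- **A toric representation with feasible potentials is an order representation of order = gap.**  If
`pp_{n,m} = u · wHC_w^e (g · det_m)` and `(p, q)` are feasible potentials for the entries of `g · x` with `e ≤ Σp + Σq`, then
`pp_{n,m} = u · [ε^k] det (B'₀ + ⋯ + ε^k B'_k)` with `k = Σp + Σq − e` and the linear layers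
`(B'_i)_ab = wHC_w^{p_a+q_b−i} (g · x_ab)`. [folklore] -/
theorem exists_orderRep_of_potentialRep {n m : ℕ} [NeZero m] (u g : Matrix (Fin m × Fin m) (Fin m × Fin m) ℂ)
    (w : Fin m × Fin m → ℕ) (e : ℕ) (p q : Fin m → ℕ)
    (hfeas : ∀ a b j, p a + q b < j →
      MvPolynomial.weightedHomogeneousComponent w j (linSubst (Fin m × Fin m) ℂ g (MvPolynomial.X (a, b))) = 0)
    (he : e ≤ ∑ a, p a + ∑ b, q b)
    (hpp : paddedPerPoly ℂ n m = linSubst (Fin m × Fin m) ℂ u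
      (MvPolynomial.weightedHomogeneousComponent w e (linSubst (Fin m × Fin m) ℂ g (detPoly (Fin m) ℂ)))) :
    ∃ B : ℕ → Matrix (Fin m) (Fin m) (MvPolynomial (Fin m × Fin m) ℂ), (∀ j a b, (B j a b).IsHomogeneous 1) ∧
      paddedPerPoly ℂ n m = linSubst (Fin m × Fin m) ℂ u
        ((Matrix.det (Matrix.of fun a b => ∑ j ∈ Finset.range ((∑ a, p a + ∑ b, q b - e) + 1),
          Polynomial.monomial j (B j a b))).coeff (∑ a, p a + ∑ b, q b - e)) := by
  set L : Matrix (Fin m) (Fin m) (MvPolynomial (Fin m × Fin m) ℂ) :=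
    (linSubst (Fin m × Fin m) ℂ g).toRingHom.mapMatrix (Matrix.mvPolynomialX (Fin m) (Fin m) ℂ) with hL
  have hLab : ∀ a b, L a b = linSubst (Fin m × Fin m) ℂ g (MvPolynomial.X (a, b)) := fun a b => by
    simp only [hL, RingHom.mapMatrix_apply, Matrix.map_apply, Matrix.mvPolynomialX_apply]; rfl
  have hdet : linSubst (Fin m × Fin m) ℂ g (detPoly (Fin m) ℂ) = L.det := by
    rw [hL, detPoly, ← RingHom.map_det]; rfl
  have hlin : ∀ a b, (L a b).IsHomogeneous 1 := fun a b => by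
    rw [hLab]; exact linSubst_isHomogeneous g (MvPolynomial.isHomogeneous_X ℂ (a, b))
  have hfeasL : ∀ a b j, p a + q b < j → MvPolynomial.weightedHomogeneousComponent w j (L a b) = 0 :=
    fun a b j hj => by rw [hLab]; exact hfeas a b j hj
  refine ⟨fun i => Matrix.of fun a b =>
      if i ≤ p a + q b then MvPolynomial.weightedHomogeneousComponent w (p a + q b - i) (L a b) else 0,
    fun i a b => ?_, ?_⟩
  · simp only [Matrix.of_apply]
    split_ifs
    · exact isHomogeneous_weightedHomogeneousComponent (hlin a b) w _
    · exact MvPolynomial.isHomogeneous_zero _ _ _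
  · rw [hpp, hdet, stub_deborderFrame (Fin m × Fin m) (Fin m) L hlin w e p q hfeasL he]
    rfl

/-- **`dc(per_n)` is polynomial in the size and the Murota gap of any toric representation of its padding** (registered
stub `stub_dcLeOfPotentialRep` of crux stmt-5778, line `toric-face-debordering`, reshape 5): a toric representation
`pp_{n,m} = u · wHC_w^e (g · det_m)` with feasible potentials `(p, q)`, `e ≤ Σp + Σq`, forces
`dc(per_n) ≤ 3((m+1)(Σp + Σq − e + 1))^10`. [folklore] -/
theorem stub_dcLeOfPotentialRep : ∀ (n m : ℕ) [NeZero m], n ≤ m → ∀ (u g : Matrix (Fin m × Fin m) (Fin m × Fin m) ℂ) (w : Fin m × Fin m → ℕ) (e : ℕ) (p q : Fin m → ℕ), (∀ a b j, p a + q b < j → MvPolynomial.weightedHomogeneousComponent w j (linSubst (Fin m × Fin m) ℂ g (MvPolynomial.X (a, b))) = 0) → e ≤ ∑ a, p a + ∑ b, q b → paddedPerPoly ℂ n m = linSubst (Fin m × Fin m) ℂ u (MvPolynomial.weightedHomogeneousComponent w e (linSubst (Fin m × Fin m) ℂ g (detPoly (Fin m) ℂ))) → determinantalComplexity (perPoly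 (Fin n) ℂ) ≤ 3 * ((m + 1) * (∑ a, p a + ∑ b, q b - e + 1)) ^ 10 := by
  intro n m _ hnm u g w e p q hfeas he hpp
  obtain ⟨B, hB, hrep⟩ := exists_orderRep_of_potentialRep u g w e p q hfeas he hpp
  exact determinantalComplexity_perPoly_le_of_orderRep hnm _ u B hB hrep

/-- Quasi-polynomial bookkeeping for the instance bound: with `K ≤ 2^((log₂ m + c₁)^c₁)`,
`3((m+1)(K+1))^10 ≤ 2^((log₂ m + c')^c')` for the `c'` of `qp_absorb 1 c₁ 3 10`. [folklore] -/
theorem instanceBound_le_qp (c₁ : ℕ) : ∃ c' : ℕ, ∀ (m K : ℕ), K ≤ 2 ^ ((Nat.log 2 m + c₁) ^ c₁) →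
    3 * ((m + 1) * (K + 1)) ^ 10 ≤ 2 ^ ((Nat.log 2 m + c') ^ c') := by
  obtain ⟨c', hc'⟩ := qp_absorb 1 c₁ 3 10
  refine ⟨c', fun m K hK => ?_⟩
  have hm : m ≤ 2 ^ ((Nat.log 2 m + 1) ^ 1) := by
    rw [pow_one]
    exact (Nat.lt_pow_succ_log_self Nat.one_lt_two m).le
  exact (Nat.mul_le_mul_left 3 (Nat.pow_le_pow_left (Nat.mul_le_mul_left (m + 1) (by omega)) 10)).trans
    (hc' m m hm)

/-- **The WINDOWED chain**: a quasi-polynomial Murota gap INSIDE THE WINDOW (`PotentialGapQPWindow`: for every `c`, for all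
large `n` and `n ≤ m ≤ 2^((log₂ n + c)^c)`, every extremal toric representation of `pp_{n,m}` can be traded for one with feasible
potentials of gap `≤ 2^((log₂ m + c₁)^c₁)`) implies the windowed de-bordering stub `ToricDeborderQPWindow` of seat c2's
`…QPNecessityWindow.lean` (same thresholds). [folklore] -/
theorem toricDeborderQPWindow_of_potentialGapQPWindow
    (hP : ∃ c₁ : ℕ, ∀ c : ℕ, ∃ n₀ : ℕ, ∀ n ≥ n₀, ∀ (m : ℕ) [NeZero m], n ≤ m →
      m ≤ 2 ^ ((Nat.log 2 n + c) ^ c) →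
      (∃ (u g : Matrix.GeneralLinearGroup (Fin m × Fin m) ℂ) (w : Fin m × Fin m → ℕ) (e : ℕ),
        (∀ d ∈ (linSubst (Fin m × Fin m) ℂ (g : Matrix (Fin m × Fin m) (Fin m × Fin m) ℂ)
          (detPoly (Fin m) ℂ)).support, Finsupp.weight w d ≤ e) ∧
        paddedPerPoly ℂ n m =
          linSubst (Fin m × Fin m) ℂ (u : Matrix (Fin m × Fin m) (Fin m × Fin m) ℂ)
            (MvPolynomial.weightedHomogeneousComponent w e
              (linSubst (Fin m × Fin m) ℂ (g : Matrix (Fin m × Fin m) (Fin m × Fin m) ℂ)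
                (detPoly (Fin m) ℂ)))) →
      ∃ (u g : Matrix (Fin m × Fin m) (Fin m × Fin m) ℂ) (w : Fin m × Fin m → ℕ) (e : ℕ) (p q : Fin m → ℕ),
        (∀ a b j, p a + q b < j →
          MvPolynomial.weightedHomogeneousComponent w j (linSubst (Fin m × Fin m) ℂ g (MvPolynomial.X (a, b))) = 0) ∧
        e ≤ ∑ a, p a + ∑ b, q b ∧
        ∑ a, p a + ∑ b, q b - e ≤ 2 ^ ((Nat.log 2 m + c₁) ^ c₁) ∧
        paddedPerPoly ℂ n m = linSubst (Fin m × Fin m) ℂ u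
          (MvPolynomial.weightedHomogeneousComponent w e (linSubst (Fin m × Fin m) ℂ g (detPoly (Fin m) ℂ)))) :
    ∃ c₁ : ℕ, ∀ c : ℕ, ∃ n₀ : ℕ, ∀ n ≥ n₀, ∀ (m : ℕ) [NeZero m], n ≤ m →
      m ≤ 2 ^ ((Nat.log 2 n + c) ^ c) →
      (∃ (u g : Matrix.GeneralLinearGroup (Fin m × Fin m) ℂ) (w : Fin m × Fin m → ℕ) (e : ℕ),
        (∀ d ∈ (linSubst (Fin m × Fin m) ℂ (g : Matrix (Fin m × Fin m) (Fin m × Fin m) ℂ)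
          (detPoly (Fin m) ℂ)).support, Finsupp.weight w d ≤ e) ∧
        paddedPerPoly ℂ n m =
          linSubst (Fin m × Fin m) ℂ (u : Matrix (Fin m × Fin m) (Fin m × Fin m) ℂ)
            (MvPolynomial.weightedHomogeneousComponent w e
              (linSubst (Fin m × Fin m) ℂ (g : Matrix (Fin m × Fin m) (Fin m × Fin m) ℂ)
                (detPoly (Fin m) ℂ)))) →
      determinantalComplexity (perPoly (Fin n) ℂ) ≤ 2 ^ ((Nat.log 2 m + c₁) ^ c₁) := by
  obtain ⟨c₁, hP⟩ := hP
  obtain ⟨c', hc'⟩ := instanceBound_le_qp c₁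
  refine ⟨c', fun c => ?_⟩
  obtain ⟨n₀, hn₀⟩ := hP c
  refine ⟨n₀, fun n hn m inst hnm hm hrep => ?_⟩
  obtain ⟨u, g, w, e, p, q, hfeas, he, hgap, hpp⟩ := @hn₀ n hn m inst hnm hm hrep
  exact (stub_dcLeOfPotentialRep n m hnm u g w e p q hfeas he hpp).trans (hc' m _ hgap)

/-- **Crux 2 from crux 3, a windowed quasi-polynomial Murota gap and eventual affine hardness**:
`ToricFixedPoints ∧ PotentialGapQPWindow ∧ (eventual super-qp dc(per_n)) ⟹ FixedWitnessObstructionQP`, through seat c2's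
`noExtremalInitialForm_of_toricDeborderQPWindow` / `fixedWitnessObstructionQP_of_noExtremalInitialForm`.  With the windowed
stubs the implication loses nothing: given `ToricFixedPoints`, the crux implies both other hypotheses back
(`fixedWitnessObstructionQP_iff_toricDeborderQPWindow_and_dc`, and the gap hypothesis vacuously). [folklore] -/
theorem fixedWitnessObstructionQP_of_potentialGapQPWindow (hT : ToricFixedPoints)
    (hP : ∃ c₁ : ℕ, ∀ c : ℕ, ∃ n₀ : ℕ, ∀ n ≥ n₀, ∀ (m : ℕ) [NeZero m], n ≤ m →
      m ≤ 2 ^ ((Nat.log 2 n + c) ^ c) →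
      (∃ (u g : Matrix.GeneralLinearGroup (Fin m × Fin m) ℂ) (w : Fin m × Fin m → ℕ) (e : ℕ),
        (∀ d ∈ (linSubst (Fin m × Fin m) ℂ (g : Matrix (Fin m × Fin m) (Fin m × Fin m) ℂ)
          (detPoly (Fin m) ℂ)).support, Finsupp.weight w d ≤ e) ∧
        paddedPerPoly ℂ n m =
          linSubst (Fin m × Fin m) ℂ (u : Matrix (Fin m × Fin m) (Fin m × Fin m) ℂ)
            (MvPolynomial.weightedHomogeneousComponent w e
              (linSubst (Fin m × Fin m) ℂ (g : Matrix (Fin m × Fin m) (Fin m × Fin m) ℂ)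
                (detPoly (Fin m) ℂ)))) →
      ∃ (u g : Matrix (Fin m × Fin m) (Fin m × Fin m) ℂ) (w : Fin m × Fin m → ℕ) (e : ℕ) (p q : Fin m → ℕ),
        (∀ a b j, p a + q b < j →
          MvPolynomial.weightedHomogeneousComponent w j (linSubst (Fin m × Fin m) ℂ g (MvPolynomial.X (a, b))) = 0) ∧
        e ≤ ∑ a, p a + ∑ b, q b ∧
        ∑ a, p a + ∑ b, q b - e ≤ 2 ^ ((Nat.log 2 m + c₁) ^ c₁) ∧
        paddedPerPoly ℂ n m = linSubst (Fin m × Fin m) ℂ u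
          (MvPolynomial.weightedHomogeneousComponent w e (linSubst (Fin m × Fin m) ℂ g (detPoly (Fin m) ℂ))))
    (hdc : ∀ c : ℕ, ∃ n₀ : ℕ, ∀ n ≥ n₀,
      2 ^ ((Nat.log 2 n + c) ^ c) < determinantalComplexity (perPoly (Fin n) ℂ)) :
    FixedWitnessObstructionQP :=
  fixedWitnessObstructionQP_of_noExtremalInitialForm hT
    (noExtremalInitialForm_of_toricDeborderQPWindow (toricDeborderQPWindow_of_potentialGapQPWindow hP) hdc)

end Summit.ValiantsHypothesis.ValiantsHypothesis.Theorems.BorderApolarityFixedWitnessObstructionQP
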